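import Mathlib.Algebra.Polynomial.Expand
import Literature.Barriers.MatrixMultiplication.UniversalMethodBarrierSliceRank
import HarnessLib

/-!
# Degeneration calculus I: substitution, composition with restrictions, Kronecker products

Topic `Literature/Barriers/MatrixMultiplication`; part of the PROOF of `UniversalMethodBarrier`
(Alman 2021). `PolyDegeneratesTo t s` (`UniversalMethodBarrier.lean`) is Alman's degeneration over
`K[λ]` (§2.4). This file makes it usable: everything is PROVED, over a commutative semiring.

## Content (Alman 2021, §2.4)

* `polySubst t A B C` — the substituted tensor over `K[λ]` (coefficient
  `Σ_{x,y,z} t_{xyz} A(x,x') B(y,y') C(z,z')`), and `IsPolyDegen h t s A B C` — "`(A,B,C)` is a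
  degeneration of order `h` from `t` to `s`"; `polyDegeneratesTo_iff` (`PolyDegeneratesTo` is
  literally `∃ h A B C, IsPolyDegen h t s A B C`).
* `polySubst_restrict_right/left`, `IsPolyDegen.restrict_right/left`,
  `PolyDegeneratesTo.trans_restrictsTo`, `TensorRestrictsTo.trans_polyDegeneratesTo` — composing a
  degeneration with a restriction on either side is a degeneration of the same order.
* `coeff_mul_of_clean`, `coeff_sum_mul_of_clean` — coefficient bookkeeping for products of
  polynomials vanishing below a given order.
* `polySubst_kronecker`, `IsPolyDegen.kronecker`, `PolyDegeneratesTo.kronecker` — the Kronecker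
  product of degenerations of orders `h, h'` is a degeneration of order `h + h'`.

Transitivity (which needs the substitution `λ ↦ λᵏ`), powers and rotations are in
`UniversalMethodBarrierDegenerationPow.lean`.

## References

* J. Alman, *Limits on the Universal Method for Matrix Multiplication*, Theory of Computing 17
  (2021), §2.4 (held: `doi-10-4086-toc-2021-v017a001`, pp. 10–11). [Alman2021]
* V. Strassen, *Relative bilinear complexity and matrix multiplication*, J. reine angew. Math.
  375/376 (1987) — degeneration order calculus, cited through [Alman2021, 32].
-/

noncomputable section

open scoped BigOperators Polynomial

namespace Literature.Barriers.MatrixMultiplication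

open Literature.Computability.AlgebraicComplexity

universe u

section Subst

variable {K : Type u} [CommSemiring K]
variable {ι κ μ ι' κ' μ' ι'' κ'' μ'' : Type*}

/-- The tensor over `K[λ]` obtained from `t` by the substitutions `x ↦ Σ_{x'} A(x,x') x'`,
`y ↦ Σ_{y'} B(y,y') y'`, `z ↦ Σ_{z'} C(z,z') z'` (Alman 2021, §2.4): coefficient
`Σ_{x,y,z} t_{xyz} A(x,x') B(y,y') C(z,z')` at `x'y'z'`. [cite: Alman2021, §2.4] -/
def polySubst [Fintype ι] [Fintype κ] [Fintype μ] (t : ι → κ → μ → K) (A : ι → ι' → K[X])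
    (B : κ → κ' → K[X]) (C : μ → μ' → K[X]) : ι' → κ' → μ' → K[X] :=
  fun a' b' c' => ∑ a, ∑ b, ∑ c, Polynomial.C (t a b c) * (A a a' * B b b' * C c c')

/-- `(A, B, C)` is a degeneration of order `h` from `t` to `s` (Alman 2021, §2.4): the substituted
tensor has `λ^h`-coefficient `s` and vanishing lower coefficients. [cite: Alman2021, §2.4] -/
def IsPolyDegen [Fintype ι] [Fintype κ] [Fintype μ] (h : ℕ) (t : ι → κ → μ → K)
    (s : ι' → κ' → μ' → K) (A : ι → ι' → K[X]) (B : κ → κ' → K[X]) (C : μ → μ' → K[X]) : Prop :=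
  ∀ a' b' c', ∀ j ≤ h, (polySubst t A B C a' b' c').coeff j = if j = h then s a' b' c' else 0

/-- `PolyDegeneratesTo` unfolded through `IsPolyDegen`. [cite: Alman2021, §2.4] -/
theorem polyDegeneratesTo_iff [Fintype ι] [Fintype κ] [Fintype μ] {t : ι → κ → μ → K}
    {s : ι' → κ' → μ' → K} :
    PolyDegeneratesTo t s ↔ ∃ (h : ℕ) (A : ι → ι' → K[X]) (B : κ → κ' → K[X]) (C : μ → μ' → K[X]),
      IsPolyDegen h t s A B C :=
  Iff.rfl

/-- An explicit degeneration witnesses `PolyDegeneratesTo`. [cite: Alman2021, §2.4] -/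
theorem IsPolyDegen.polyDegeneratesTo [Fintype ι] [Fintype κ] [Fintype μ] {h : ℕ}
    {t : ι → κ → μ → K} {s : ι' → κ' → μ' → K} {A : ι → ι' → K[X]} {B : κ → κ' → K[X]}
    {C : μ → μ' → K[X]} (hd : IsPolyDegen h t s A B C) : PolyDegeneratesTo t s :=
  ⟨h, A, B, C, hd⟩

/-- Distributing a scalar over a product of three finite sums. [folklore] -/
theorem mul_sum_mul_sum_mul_sum {R : Type*} [CommSemiring R] {α β γ : Type*} (sa : Finset α)
    (sb : Finset β) (sc : Finset γ) (x : R) (f : α → R) (g : β → R) (k : γ → R) :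
    x * ((∑ a ∈ sa, f a) * (∑ b ∈ sb, g b) * (∑ c ∈ sc, k c)) =
      ∑ a ∈ sa, ∑ b ∈ sb, ∑ c ∈ sc, x * (f a * g b * k c) := by
  rw [Finset.sum_mul_sum, Finset.sum_mul, Finset.mul_sum]
  refine Finset.sum_congr rfl fun a _ => ?_
  rw [Finset.sum_mul, Finset.mul_sum]
  refine Finset.sum_congr rfl fun b _ => ?_
  rw [Finset.mul_sum, Finset.mul_sum]

/-- **Degeneration followed by restriction**: substituting further with constant matrices
`A', B', C'` gives `Σ_{x',y',z'} A'B'C' · polySubst`. [cite: Alman2021, §2.4] -/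
theorem polySubst_restrict_right [Fintype ι] [Fintype κ] [Fintype μ] [Fintype ι'] [Fintype κ']
    [Fintype μ'] (t : ι → κ → μ → K) (A : ι → ι' → K[X]) (B : κ → κ' → K[X]) (C : μ → μ' → K[X])
    (A' : ι'' → ι' → K) (B' : κ'' → κ' → K) (C' : μ'' → μ' → K) (a'' : ι'') (b'' : κ'') (c'' : μ'') :
    polySubst t (fun a a'' => ∑ a', A a a' * Polynomial.C (A' a'' a'))
        (fun b b'' => ∑ b', B b b' * Polynomial.C (B' b'' b'))
        (fun c c'' => ∑ c', C c c' * Polynomial.C (C' c'' c')) a'' b'' c'' =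
      ∑ a', ∑ b', ∑ c', Polynomial.C (A' a'' a') * Polynomial.C (B' b'' b') *
        Polynomial.C (C' c'' c') * polySubst t A B C a' b' c' := by
  simp only [polySubst, mul_sum_mul_sum_mul_sum]
  -- RHS: distribute the constants into the triple sum over `a b c`
  simp only [Finset.mul_sum]
  -- LHS binders `a b c a' b' c'`, RHS binders `a' b' c' a b c`
  rw [sum_comm₃]
  refine Finset.sum_congr rfl fun a' _ => Finset.sum_congr rfl fun b' _ =>
    Finset.sum_congr rfl fun c' _ => Finset.sum_congr rfl fun a _ =>
    Finset.sum_congr rfl fun b _ => Finset.sum_congr rfl fun c _ => ?_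
  ring

/-- **Restriction followed by degeneration**: if `s = (A₀ ⊗ B₀ ⊗ C₀) t` then substituting in `s`
is substituting in `t` with the composed maps. [cite: Alman2021, §2.4] -/
theorem polySubst_restrict_left [Fintype ι] [Fintype κ] [Fintype μ] [Fintype ι'] [Fintype κ']
    [Fintype μ'] {t : ι → κ → μ → K} {s : ι' → κ' → μ' → K} (A₀ : ι' → ι → K) (B₀ : κ' → κ → K)
    (C₀ : μ' → μ → K) (hs : ∀ a' b' c', s a' b' c' = ∑ a, ∑ b, ∑ c, A₀ a' a * B₀ b' b * C₀ c' c * t a b c)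
    (A : ι' → ι'' → K[X]) (B : κ' → κ'' → K[X]) (C : μ' → μ'' → K[X]) (a'' : ι'') (b'' : κ'')
    (c'' : μ'') :
    polySubst s A B C a'' b'' c'' =
      polySubst t (fun a a'' => ∑ a', Polynomial.C (A₀ a' a) * A a' a'')
        (fun b b'' => ∑ b', Polynomial.C (B₀ b' b) * B b' b'')
        (fun c c'' => ∑ c', Polynomial.C (C₀ c' c) * C c' c'') a'' b'' c'' := by
  have lhs : polySubst s A B C a'' b'' c'' = ∑ a', ∑ b', ∑ c', ∑ a, ∑ b, ∑ c,
      Polynomial.C (A₀ a' a * B₀ b' b * C₀ c' c * t a b c) * (A a' a'' * B b' b'' * C c' c'') := by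
    simp only [polySubst, hs, map_sum, Finset.sum_mul]
  rw [lhs]
  simp only [polySubst, mul_sum_mul_sum_mul_sum, map_mul]
  -- LHS binders `a' b' c' a b c`, RHS binders `a b c a' b' c'`
  rw [sum_comm₃]
  refine Finset.sum_congr rfl fun a _ => Finset.sum_congr rfl fun b _ =>
    Finset.sum_congr rfl fun c _ => Finset.sum_congr rfl fun a' _ =>
    Finset.sum_congr rfl fun b' _ => Finset.sum_congr rfl fun c' _ => ?_
  ring

/-- Degeneration then restriction is a degeneration (of the same order). [cite: Alman2021, §2.4] -/
theorem IsPolyDegen.restrict_right [Fintype ι] [Fintype κ] [Fintype μ] [Fintype ι'] [Fintype κ']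
    [Fintype μ'] {h : ℕ} {t : ι → κ → μ → K} {s : ι' → κ' → μ' → K} {A : ι → ι' → K[X]}
    {B : κ → κ' → K[X]} {C : μ → μ' → K[X]} (hd : IsPolyDegen h t s A B C) {p : ι'' → κ'' → μ'' → K}
    (A' : ι'' → ι' → K) (B' : κ'' → κ' → K) (C' : μ'' → μ' → K)
    (hp : ∀ a'' b'' c'', p a'' b'' c'' = ∑ a', ∑ b', ∑ c', A' a'' a' * B' b'' b' * C' c'' c' * s a' b' c') :
    IsPolyDegen h t p (fun a a'' => ∑ a', A a a' * Polynomial.C (A' a'' a'))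
      (fun b b'' => ∑ b', B b b' * Polynomial.C (B' b'' b'))
      (fun c c'' => ∑ c', C c c' * Polynomial.C (C' c'' c')) := by
  intro a'' b'' c'' j hj
  rw [polySubst_restrict_right]
  simp only [Polynomial.finsetSum_coeff, ← map_mul, Polynomial.coeff_C_mul, hd _ _ _ j hj]
  split_ifs with hjh
  · rw [hp]
  · simp

/-- Restriction then degeneration is a degeneration (of the same order). [cite: Alman2021, §2.4] -/
theorem IsPolyDegen.restrict_left [Fintype ι] [Fintype κ] [Fintype μ] [Fintype ι'] [Fintype κ']
    [Fintype μ'] {h : ℕ} {t : ι → κ → μ → K} {s : ι' → κ' → μ' → K} {p : ι'' → κ'' → μ'' → K}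
    {A : ι' → ι'' → K[X]} {B : κ' → κ'' → K[X]} {C : μ' → μ'' → K[X]} (hd : IsPolyDegen h s p A B C)
    (A₀ : ι' → ι → K) (B₀ : κ' → κ → K) (C₀ : μ' → μ → K)
    (hs : ∀ a' b' c', s a' b' c' = ∑ a, ∑ b, ∑ c, A₀ a' a * B₀ b' b * C₀ c' c * t a b c) :
    IsPolyDegen h t p (fun a a'' => ∑ a', Polynomial.C (A₀ a' a) * A a' a'')
      (fun b b'' => ∑ b', Polynomial.C (B₀ b' b) * B b' b'')
      (fun c c'' => ∑ c', Polynomial.C (C₀ c' c) * C c' c'') := by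
  intro a'' b'' c'' j hj
  rw [← polySubst_restrict_left A₀ B₀ C₀ hs]
  exact hd a'' b'' c'' j hj

/-- `t ⊵ s ≥ p ⇒ t ⊵ p`. [cite: Alman2021, §2.4] -/
theorem PolyDegeneratesTo.trans_restrictsTo [Fintype ι] [Fintype κ] [Fintype μ] [Fintype ι']
    [Fintype κ'] [Fintype μ'] {t : ι → κ → μ → K} {s : ι' → κ' → μ' → K} {p : ι'' → κ'' → μ'' → K}
    (hts : PolyDegeneratesTo t s) (hsp : TensorRestrictsTo s p) : PolyDegeneratesTo t p := by
  obtain ⟨h, A, B, C, hd⟩ := hts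
  obtain ⟨A', B', C', hp⟩ := hsp
  exact (IsPolyDegen.restrict_right hd A' B' C' hp).polyDegeneratesTo

/-- `t ≥ s ⊵ p ⇒ t ⊵ p`. [cite: Alman2021, §2.4] -/
theorem _root_.Literature.Computability.AlgebraicComplexity.TensorRestrictsTo.trans_polyDegeneratesTo
    [Fintype ι] [Fintype κ] [Fintype μ] [Fintype ι'] [Fintype κ'] [Fintype μ'] {t : ι → κ → μ → K}
    {s : ι' → κ' → μ' → K} {p : ι'' → κ'' → μ'' → K} (hts : TensorRestrictsTo t s)
    (hsp : PolyDegeneratesTo s p) : PolyDegeneratesTo t p := by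
  obtain ⟨A₀, B₀, C₀, hs⟩ := hts
  obtain ⟨h, A, B, C, hd⟩ := hsp
  exact (IsPolyDegen.restrict_left hd A₀ B₀ C₀ hs).polyDegeneratesTo

/-! ### Coefficient bookkeeping -/

/-- The product of two polynomials that are "clean up to their orders" `h`, `h'` (vanishing below,
prescribed coefficient at the order) is clean up to order `h + h'`. [folklore] -/
theorem coeff_mul_of_clean {P Q : K[X]} {h h' : ℕ} {x y : K}
    (hP : ∀ i ≤ h, P.coeff i = if i = h then x else 0)
    (hQ : ∀ i ≤ h', Q.coeff i = if i = h' then y else 0) (j : ℕ) (hj : j ≤ h + h') :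
    (P * Q).coeff j = if j = h + h' then x * y else 0 := by
  rw [Polynomial.coeff_mul]
  by_cases hjj : j = h + h'
  · rw [if_pos hjj, Finset.sum_eq_single (h, h')]
    · rw [hP h le_rfl, hQ h' le_rfl, if_pos rfl, if_pos rfl]
    · rintro ⟨i, i'⟩ hii' hne
      rw [Finset.mem_antidiagonal] at hii'
      dsimp only at hii' ⊢
      by_cases hi : i ≤ h
      · have hi' : i ≠ h := fun e => hne (by subst e; congr 1; omega)
        rw [hP i hi, if_neg hi', zero_mul]
      · have h2 : i' < h' := by omega
        rw [hQ i' h2.le, if_neg h2.ne, mul_zero]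
    · intro hmem
      exact absurd (Finset.mem_antidiagonal.2 hjj.symm) hmem
  · rw [if_neg hjj]
    refine Finset.sum_eq_zero ?_
    rintro ⟨i, i'⟩ hii'
    rw [Finset.mem_antidiagonal] at hii'
    dsimp only at hii' ⊢
    by_cases hi : i < h
    · rw [hP i hi.le, if_neg hi.ne, zero_mul]
    · have h2 : i' < h' := by omega
      rw [hQ i' h2.le, if_neg h2.ne, mul_zero]

/-- Coefficients up to order `m` of `Σ_k P_k Q_k` when every `P_k` is clean of order `e ≤ m` up to
`m`: they are the shifted coefficients of `Σ_k x_k Q_k`. [folklore] -/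
theorem coeff_sum_mul_of_clean {σ : Type*} (S : Finset σ) {P Q : σ → K[X]} {e m : ℕ}
    {x : σ → K} (hP : ∀ k ∈ S, ∀ i ≤ m, (P k).coeff i = if i = e then x k else 0)
    (j : ℕ) (hj : j ≤ m) :
    (∑ k ∈ S, P k * Q k).coeff j =
      if e ≤ j then (∑ k ∈ S, Polynomial.C (x k) * Q k).coeff (j - e) else 0 := by
  rw [Polynomial.finsetSum_coeff]
  have hterm : ∀ k ∈ S, (P k * Q k).coeff j =
      if e ≤ j then x k * (Q k).coeff (j - e) else 0 := by
    intro k hk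
    rw [Polynomial.coeff_mul, Finset.Nat.sum_antidiagonal_eq_sum_range_succ_mk]
    have h2 : ∀ i ∈ Finset.range (j + 1), (P k).coeff i * (Q k).coeff (j - i) =
        if e = i then x k * (Q k).coeff (j - i) else 0 := by
      intro i hi
      have hi' : i ≤ m := (Nat.lt_succ_iff.1 (Finset.mem_range.1 hi)).trans hj
      rw [hP k hk i hi']
      by_cases hie : i = e
      · subst hie; simp
      · rw [if_neg hie, if_neg (Ne.symm hie), zero_mul]
    rw [Finset.sum_congr rfl h2, Finset.sum_ite_eq]
    simp only [Finset.mem_range, Nat.lt_succ_iff]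
  rw [Finset.sum_congr rfl hterm]
  split_ifs with hej
  · rw [Polynomial.finsetSum_coeff]
    exact Finset.sum_congr rfl fun k _ => by rw [Polynomial.coeff_C_mul]
  · exact Finset.sum_const_zero

/-! ### Kronecker products of degenerations -/

/-- Substituting in a Kronecker product with product maps is the product of the substitutions.
[cite: Alman2021, §2.4] -/
theorem polySubst_kronecker {ι₁ κ₁ μ₁ ι₁' κ₁' μ₁' : Type*} [Fintype ι] [Fintype κ] [Fintype μ]
    [Fintype ι₁] [Fintype κ₁] [Fintype μ₁] (t : ι → κ → μ → K) (t₁ : ι₁ → κ₁ → μ₁ → K)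
    (A : ι → ι' → K[X]) (B : κ → κ' → K[X]) (C : μ → μ' → K[X]) (A₁ : ι₁ → ι₁' → K[X])
    (B₁ : κ₁ → κ₁' → K[X]) (C₁ : μ₁ → μ₁' → K[X]) (a' : ι' × ι₁') (b' : κ' × κ₁') (c' : μ' × μ₁') :
    polySubst (kroneckerTensor t t₁) (fun a a' => A a.1 a'.1 * A₁ a.2 a'.2)
        (fun b b' => B b.1 b'.1 * B₁ b.2 b'.2) (fun c c' => C c.1 c'.1 * C₁ c.2 c'.2) a' b' c' =
      polySubst t A B C a'.1 b'.1 c'.1 * polySubst t₁ A₁ B₁ C₁ a'.2 b'.2 c'.2 := by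
  simp only [polySubst]
  rw [Fintype.sum_prod_type]
  simp only [Fintype.sum_prod_type (f := fun b : κ × κ₁ => _)]
  simp only [Fintype.sum_prod_type, kroneckerTensor_apply, map_mul]
  -- RHS: product of two triple sums
  simp_rw [Finset.sum_mul]
  simp_rw [Finset.mul_sum]
  -- LHS binders `a a₁ b b₁ c c₁`, RHS binders `a b c a₁ b₁ c₁`
  conv_rhs => rw [sum_interleave₃]
  refine Finset.sum_congr rfl fun a _ => Finset.sum_congr rfl fun a₁ _ =>
    Finset.sum_congr rfl fun b _ => Finset.sum_congr rfl fun b₁ _ =>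
    Finset.sum_congr rfl fun c _ => Finset.sum_congr rfl fun c₁ _ => ?_
  ring

/-- **Kronecker product of degenerations**: orders add. [cite: Alman2021, §2.4] -/
theorem IsPolyDegen.kronecker {ι₁ κ₁ μ₁ ι₁' κ₁' μ₁' : Type*} [Fintype ι] [Fintype κ] [Fintype μ]
    [Fintype ι₁] [Fintype κ₁] [Fintype μ₁] {h h₁ : ℕ} {t : ι → κ → μ → K} {s : ι' → κ' → μ' → K}
    {A : ι → ι' → K[X]} {B : κ → κ' → K[X]} {C : μ → μ' → K[X]} (hd : IsPolyDegen h t s A B C)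
    {t₁ : ι₁ → κ₁ → μ₁ → K} {s₁ : ι₁' → κ₁' → μ₁' → K} {A₁ : ι₁ → ι₁' → K[X]}
    {B₁ : κ₁ → κ₁' → K[X]} {C₁ : μ₁ → μ₁' → K[X]} (hd₁ : IsPolyDegen h₁ t₁ s₁ A₁ B₁ C₁) :
    IsPolyDegen (h + h₁) (kroneckerTensor t t₁) (kroneckerTensor s s₁)
      (fun a a' => A a.1 a'.1 * A₁ a.2 a'.2) (fun b b' => B b.1 b'.1 * B₁ b.2 b'.2)
      (fun c c' => C c.1 c'.1 * C₁ c.2 c'.2) := by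
  intro a' b' c' j hj
  rw [polySubst_kronecker, kroneckerTensor_apply]
  exact coeff_mul_of_clean (hd a'.1 b'.1 c'.1) (hd₁ a'.2 b'.2 c'.2) j hj

/-- `t ⊵ s`, `t₁ ⊵ s₁ ⇒ t ⊗ t₁ ⊵ s ⊗ s₁`. [cite: Alman2021, §2.4] -/
theorem PolyDegeneratesTo.kronecker {ι₁ κ₁ μ₁ ι₁' κ₁' μ₁' : Type*} [Fintype ι] [Fintype κ]
    [Fintype μ] [Fintype ι₁] [Fintype κ₁] [Fintype μ₁] {t : ι → κ → μ → K} {s : ι' → κ' → μ' → K}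
    {t₁ : ι₁ → κ₁ → μ₁ → K} {s₁ : ι₁' → κ₁' → μ₁' → K} (hts : PolyDegeneratesTo t s)
    (hts₁ : PolyDegeneratesTo t₁ s₁) :
    PolyDegeneratesTo (kroneckerTensor t t₁) (kroneckerTensor s s₁) := by
  obtain ⟨h, A, B, C, hd⟩ := hts
  obtain ⟨h₁, A₁, B₁, C₁, hd₁⟩ := hts₁
  exact (IsPolyDegen.kronecker hd hd₁).polyDegeneratesTo

end Subst

end Literature.Barriers.MatrixMultiplication

end
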